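import Summits.HubbardSuperconductivity.HubbardSuperconductivity.Theorems.AnisotropyChordTransferFibre3GroundFormulas

/-!
# Route `AnisotropyChord` / H0 rotor rung: `Δ` AS AN EXPLICIT FUNCTION OF `λ₂` for the ground profile (the Level-2 change of variables)

LEVEL2-SPEC §2/§4 parametrises the certificate by `λ = λ₂` (cells in `ν = λ/θ²`) and recovers the anisotropy through the gap equation
`Δ·(4/(Vλ) + 1 − 1/V − (4−λ)G̃_λ(0)) = 4/(Vλ) − 4G̃_λ(0)` (`ground_deltaExplicit`).  Here the equation is SOLVED:
* `deltaOfLam L lam := (4/(V·lam) − 4G̃_lam(0)) / (4/(V·lam) + 1 − 1/V − (4 − lam)G̃_lam(0))`;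
* `ground_delta_den_pos`: the denominator is positive (it exceeds the numerator by `1 − 1/V + λ₂G̃_{λ₂}(0) > 0`, and `Δ < 1`);
* ★ `ground_delta_eq`: **`Δ = deltaOfLam L λ₂`** for the ground two-magnon profile (`L ≥ 5`, `0 ≤ Δ < 1`) — so a λ-cell producer
  may treat `Δ` as this explicit function, and `forall_ground_of_window_*` (…CruxWindow) restricts `λ₂` to the a-priori window.
Prover seat `hubbard-h0-rotor-p1` g24; helper for stmt-HubbardSuperconductivity-19089 (`--supports`).
-/

set_option linter.dupNamespace false
set_option autoImplicit false

noncomputable section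

open scoped BigOperators
open Complex

namespace Summit.HubbardSuperconductivity.HubbardSuperconductivity.Theorems.AnisotropyChord.Transfer.Fibre3

variable (L : ℕ) [NeZero L]

/-- the anisotropy as an explicit function of the ground eigenvalue: `Δ(λ) = (4/(Vλ) − 4G̃_λ(0)) / (4/(Vλ) + 1 − 1/V − (4−λ)G̃_λ(0))`. [folklore] -/
def deltaOfLam (lam : ℝ) : ℝ :=
  (4 / ((L : ℝ) ^ 2 * lam) - 4 * Gres L lam 0)
    / (4 / ((L : ℝ) ^ 2 * lam) + 1 - 1 / (L : ℝ) ^ 2 - (4 - lam) * Gres L lam 0)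

/-- the denominator of `Δ(λ₂)` is positive for the ground profile (`L ≥ 5`, `0 ≤ Δ < 1`). [folklore] -/
theorem ground_delta_den_pos (hL : 5 ≤ L) {Δ lam2 : ℝ} (hΔ0 : 0 ≤ Δ) (hΔ1 : Δ < 1) {f : Tor L → ℝ}
    (hf : IsGroundTwoMagnon L Δ lam2 f) :
    0 < 4 / ((L : ℝ) ^ 2 * lam2) + 1 - 1 / (L : ℝ) ^ 2 - (4 - lam2) * Gres L lam2 0 := by
  have hgap := ground_deltaExplicit L hL hΔ0 hΔ1 hf
  have hpos := lam2_pos L (by omega) hΔ1 hf.1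
  have hlt := lam2_lt_two_eps1 L hL hΔ0 hf
  have hGmono := Gres_zero_zero_mono L (by omega) hpos.le hlt
  have hG0 := Gres_zero_zero_pos L (by omega)
  have hG : 0 < Gres L lam2 0 := lt_of_lt_of_le hG0 hGmono
  have hV : (1 : ℝ) < (L : ℝ) ^ 2 := by
    have : (5 : ℝ) ≤ L := by exact_mod_cast hL
    nlinarith
  have hV1 : 0 < 1 - 1 / (L : ℝ) ^ 2 := by
    rw [sub_pos, div_lt_one (by linarith)]; exact hV
  -- D − N = 1 − 1/V + λ G̃ > 0 and N = Δ·D with Δ < 1 ⇒ D > 0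
  set D := 4 / ((L : ℝ) ^ 2 * lam2) + 1 - 1 / (L : ℝ) ^ 2 - (4 - lam2) * Gres L lam2 0 with hD
  set N := 4 / ((L : ℝ) ^ 2 * lam2) - 4 * Gres L lam2 0 with hN
  have hDN : D - N = 1 - 1 / (L : ℝ) ^ 2 + lam2 * Gres L lam2 0 := by rw [hD, hN]; ring
  have hDN' : 0 < D - N := by rw [hDN]; nlinarith
  by_contra hc
  have hD0 : D ≤ 0 := le_of_not_gt hc
  -- then N = Δ D ≥ D (as D ≤ 0 and Δ ≤ 1)... contradiction with D − N > 0
  have : N = Δ * D := by rw [hN, hD]; linarith [hgap]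
  nlinarith

/-- ★ **`Δ = Δ(λ₂)`** explicitly, for the ground two-magnon profile (`L ≥ 5`, `0 ≤ Δ < 1`). [folklore] -/
theorem ground_delta_eq (hL : 5 ≤ L) {Δ lam2 : ℝ} (hΔ0 : 0 ≤ Δ) (hΔ1 : Δ < 1) {f : Tor L → ℝ}
    (hf : IsGroundTwoMagnon L Δ lam2 f) : Δ = deltaOfLam L lam2 := by
  have hgap := ground_deltaExplicit L hL hΔ0 hΔ1 hf
  have hden := ground_delta_den_pos L hL hΔ0 hΔ1 hf
  unfold deltaOfLam
  rw [eq_div_iff hden.ne']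
  linarith

end Summit.HubbardSuperconductivity.HubbardSuperconductivity.Theorems.AnisotropyChord.Transfer.Fibre3

end
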